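import Mathlib.Analysis.Complex.ExponentialBounds
import Mathlib.Analysis.SpecialFunctions.Pow.Real
import Mathlib.Tactic
import Literature.NumberTheory.Irrationality.Zudilin2003.CatalanRecursion
import Literature.NumberTheory.Transcendental.ZetaLinearFormsCriterion
import Summits.KontsevichZagierPeriods.Zeta5Search.KernelKit
import HarnessLib

/-!
# ζ(5) search — kernel certificates and the exact margin for Zudilin's Catalan recursion

HONEST FRAMING: systematic search; no irrationality claim unless certified.

Cell `pub-zeta5` (summit KontsevichZagierPeriods, topic Zeta5Search), seat P1; family II of the cell's
near-miss table: Zudilin's second-order Apéry-like recursion for Catalan's constant `G`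
(`Literature.NumberTheory.Irrationality.Zudilin2003.CatalanRecursion`: `u, v`, forms `u_n G - v_n`).

KERNEL CERTIFICATES (`decide +kernel`, exact rational arithmetic, default heartbeats), for every `1 ≤ n ≤ 60`:
* Theorem 1's inclusions (5) (PROVED in print for all `n`): `2^{4n+3} D_n u_n ∈ ℤ`, `2^{4n+3} D_{2n-1}³ v_n ∈ ℤ`;
* the SHARPER inclusions of Sect. 4, which the source reports as experimental ("up to `n = 1000`"):
  `2^{4n} u_n ∈ ℤ`, `2^{4n} D_{2n-1}² v_n ∈ ℤ` — here kernel-checked, and complemented by the exact 2-adic orders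
  `v₂(u_n) = 2 s₂(n) - 4n`, `v₂(v_n) = 2 s₂(n) - 1 - 4n` (`s₂` = binary digit sum, `KernelKit.bitsum`) and the sharpness test
  `2^{4n} D_{2n-1} v_n ∉ ℤ` (`n ≥ 2`): no denominator saving beyond `D_{2n-1}²` and `n^{O(1)}` powers of `2` on this range;
* positivity `u_n > 0`, `v_n > 0`.

MARGIN (conditional on the named fact `Zudilin2003.rates` — Poincaré asymptotics as stated in the source — and
the tree-proved prime number theorem): `log(2^{4n} D_{2n-1}² |u_n G - v_n|)/n → r` with `4.366 < r < 4.367`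
(`r = 4 log 2 + 4 - 5 log((1+√5)/2) = 4.36652969…`): the integer-normalised forms grow; in the cell's units,
decay `c = 5 log((1+√5)/2) = 2.40605912…`, denominator rate `δ = 4 log 2 + 4 = 6.77258872…` (observed
denominators; `4 log 2 + 6` with the proved ones, since `D_n ∣ D_{2n-1}` — referee R3), savings `φ = 0`, margin `c - δ = -4.3665… < 0`.
Nothing here is a claim about the arithmetic nature of `G`.
-/

namespace Summit.KontsevichZagierPeriods.Zeta5Search.CatalanFamily

open Finset Filter Set
open scoped Topology
open Literature.NumberTheory.Irrationality
open Literature.NumberTheory.Irrationality.Zudilin2003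
open Literature.NumberTheory.Transcendental (catalanConstant tendsto_log_lcmUpto_div)
open Summit.KontsevichZagierPeriods.Zeta5Search.KernelKit

/-! ### Kernel certificates, `1 ≤ n ≤ 60` -/

/-- Parity of the reduced denominator: `true` iff the denominator of `x` is odd (no factor `2` left). -/
def oddDenB (x : ℚ) : Bool := x.den % 2 == 1

/-- The tests at index `n`, with `d = D_n = lcm(1..n)`, `d₂ = D_{2n-1}`, `s = s₂(n)` (binary digit sum):
(i) `2^{4n+3} d u_n ∈ ℤ`, (ii) `2^{4n+3} d₂³ v_n ∈ ℤ` (Theorem 1, (5)); (iii) `2^{4n} u_n ∈ ℤ`, (iv) `2^{4n} d₂² v_n ∈ ℤ`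
(Sect. 4, observed); (v) `u_n > 0`, (vi) `v_n > 0`; (vii) the denominator of `2^{4n-2s} u_n` is odd but that of
`2^{4n-2s-1} u_n` is even (`v₂(u_n) = 2s - 4n` exactly); (viii) likewise `v₂(v_n) = 2s - 1 - 4n` exactly;
(ix) for `n ≥ 2`, `2^{4n} d₂ v_n ∉ ℤ` (the square on `D_{2n-1}` is needed). -/
def catOK (n : ℕ) : Bool :=
  let d : ℚ := lcmRun n
  let d₂ : ℚ := lcmRun (2 * n - 1)
  let s := bitsum n
  isIntegerB (2 ^ (4 * n + 3) * d * u n) && isIntegerB (2 ^ (4 * n + 3) * d₂ ^ 3 * v n)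
    && isIntegerB (2 ^ (4 * n) * u n) && isIntegerB (2 ^ (4 * n) * d₂ ^ 2 * v n)
    && posRatB (u n) && posRatB (v n)
    && oddDenB (2 ^ (4 * n - 2 * s) * u n) && !oddDenB (2 ^ (4 * n - 2 * s - 1) * u n)
    && oddDenB (2 ^ (4 * n + 1 - 2 * s) * v n) && !oddDenB (2 ^ (4 * n - 2 * s) * v n)
    && (decide (n < 2) || !isIntegerB (2 ^ (4 * n) * d₂ * v n))

/-- All tests for `n = a, …, a + fuel - 1`. -/
def catCheckAux : ℕ → ℕ → Bool
  | _, 0 => true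
  | a, fuel + 1 => catOK a && catCheckAux (a + 1) fuel

/-- Soundness of `catCheckAux`. -/
theorem catCheckAux_sound : ∀ (fuel a : ℕ), catCheckAux a fuel = true →
    ∀ m, a ≤ m → m < a + fuel → catOK m = true := by
  intro fuel
  induction fuel with
  | zero => intro a _ m h1 h2; omega
  | succ fuel ih =>
    intro a h m h1 h2
    simp only [catCheckAux, Bool.and_eq_true] at h
    rcases Nat.lt_or_ge a m with hlt | hge
    · exact ih (a + 1) h.2 m hlt (by omega)
    · have hm : m = a := by omega
      subst hm; exact h.1

/-- **The kernel computation**: all tests pass for every `1 ≤ n ≤ 60` (exact rational arithmetic). -/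
theorem catCheck_holds : catCheckAux 1 60 = true := by
  decide +kernel

/-- Unpacking the tests at `n`. -/
theorem catOK_spec {n : ℕ} (h : catOK n = true) :
    (∃ z : ℤ, (z : ℚ) = 2 ^ (4 * n + 3) * (Nat.lcmUpto n : ℚ) * u n)
    ∧ (∃ z : ℤ, (z : ℚ) = 2 ^ (4 * n + 3) * (Nat.lcmUpto (2 * n - 1) : ℚ) ^ 3 * v n)
    ∧ (∃ z : ℤ, (z : ℚ) = 2 ^ (4 * n) * u n)
    ∧ (∃ z : ℤ, (z : ℚ) = 2 ^ (4 * n) * (Nat.lcmUpto (2 * n - 1) : ℚ) ^ 2 * v n)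
    ∧ 0 < u n ∧ 0 < v n
    ∧ ((2 ^ (4 * n - 2 * bitsum n) * u n).den % 2 = 1 ∧ (2 ^ (4 * n - 2 * bitsum n - 1) * u n).den % 2 ≠ 1)
    ∧ ((2 ^ (4 * n + 1 - 2 * bitsum n) * v n).den % 2 = 1 ∧ (2 ^ (4 * n - 2 * bitsum n) * v n).den % 2 ≠ 1)
    ∧ (2 ≤ n → ¬ ∃ z : ℤ, (z : ℚ) = 2 ^ (4 * n) * (Nat.lcmUpto (2 * n - 1) : ℚ) * v n) := by
  simp only [catOK, Bool.and_eq_true, Bool.not_eq_true', Bool.or_eq_true, lcmRun_eq, decide_eq_true_eq,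
    oddDenB, beq_iff_eq, beq_eq_false_iff_ne] at h
  obtain ⟨⟨⟨⟨⟨⟨⟨⟨⟨⟨h1, h2⟩, h3⟩, h4⟩, h5⟩, h6⟩, h7⟩, h8⟩, h9⟩, h10⟩, h11⟩ := h
  refine ⟨exists_int_of_isIntegerB h1, exists_int_of_isIntegerB h2, exists_int_of_isIntegerB h3,
    exists_int_of_isIntegerB h4, pos_of_posRatB h5, pos_of_posRatB h6, ⟨h7, h8⟩, ⟨h9, h10⟩, fun hn => ?_⟩
  rcases h11 with h11 | h11
  · omega
  · exact not_exists_int_of_isIntegerB h11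

/-- **Certificate II.1 (Theorem 1's inclusions (5) and positivity, kernel-checked for `1 ≤ n ≤ 60`).**
`2^{4n+3} D_n u_n ∈ ℤ`, `2^{4n+3} D_{2n-1}³ v_n ∈ ℤ`, `u_n, v_n > 0` (PROVED in the source for all `n`;
here an exact consistency check of the typed data). -/
theorem theorem1_checked {n : ℕ} (h1 : 1 ≤ n) (h60 : n ≤ 60) :
    (∃ z : ℤ, (z : ℚ) = 2 ^ (4 * n + 3) * (Nat.lcmUpto n : ℚ) * u n)
    ∧ (∃ z : ℤ, (z : ℚ) = 2 ^ (4 * n + 3) * (Nat.lcmUpto (2 * n - 1) : ℚ) ^ 3 * v n)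
    ∧ 0 < u n ∧ 0 < v n := by
  have h := catOK_spec (catCheckAux_sound 60 1 catCheck_holds n h1 (by omega))
  exact ⟨h.1, h.2.1, h.2.2.2.2.1, h.2.2.2.2.2.1⟩

/-- **Certificate II.2 (the sharper inclusions of Sect. 4, kernel-checked for `1 ≤ n ≤ 60`).** The source reports
`2^{4n} u_n ∈ ℤ`, `2^{4n} D_{2n-1}² v_n ∈ ℤ` as experimental; here they are exact theorems on the range. -/
theorem sharper_inclusions {n : ℕ} (h1 : 1 ≤ n) (h60 : n ≤ 60) :
    (∃ z : ℤ, (z : ℚ) = 2 ^ (4 * n) * u n)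
    ∧ (∃ z : ℤ, (z : ℚ) = 2 ^ (4 * n) * (Nat.lcmUpto (2 * n - 1) : ℚ) ^ 2 * v n) := by
  have h := catOK_spec (catCheckAux_sound 60 1 catCheck_holds n h1 (by omega))
  exact ⟨h.2.2.1, h.2.2.2.1⟩

/-- **Certificate II.3 (exact 2-adic orders and sharpness, kernel-checked for `1 ≤ n ≤ 60`).**
`v₂(u_n) = 2s₂(n) - 4n` and `v₂(v_n) = 2s₂(n) - 1 - 4n` exactly (`s₂` = binary digit sum, `KernelKit.bitsum`;
stated through the parity of reduced denominators), and for `n ≥ 2` the square on `D_{2n-1}` cannot be dropped: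
`2^{4n} D_{2n-1} v_n ∉ ℤ`. So on this range the family has no arithmetic savings beyond Sect. 4 except the
`2^{2s₂(n)} = n^{O(1)}` powers of two. -/
theorem two_adic_and_sharpness {n : ℕ} (h1 : 1 ≤ n) (h60 : n ≤ 60) :
    ((2 ^ (4 * n - 2 * bitsum n) * u n).den % 2 = 1 ∧ (2 ^ (4 * n - 2 * bitsum n - 1) * u n).den % 2 ≠ 1)
    ∧ ((2 ^ (4 * n + 1 - 2 * bitsum n) * v n).den % 2 = 1
        ∧ (2 ^ (4 * n - 2 * bitsum n) * v n).den % 2 ≠ 1)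
    ∧ (2 ≤ n → ¬ ∃ z : ℤ, (z : ℚ) = 2 ^ (4 * n) * (Nat.lcmUpto (2 * n - 1) : ℚ) * v n) := by
  have h := catOK_spec (catCheckAux_sound 60 1 catCheck_holds n h1 (by omega))
  exact ⟨h.2.2.2.2.2.2.1, h.2.2.2.2.2.2.2.1, h.2.2.2.2.2.2.2.2⟩

/-! ### The exact margin (conditional on the published rates) -/

section Margin

/-- `2.2360679 < √5 < 2.236068`. -/
theorem sqrt_five_bounds : (22360679 / 10 ^ 7 : ℝ) < Real.sqrt 5 ∧ Real.sqrt 5 < 2236068 / 10 ^ 6 := by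
  constructor
  · rw [Real.lt_sqrt (by norm_num)]; norm_num
  · rw [Real.sqrt_lt' (by norm_num)]; norm_num

/-- `0.61797 < e^{-0.4813}`… precisely `(√5-1)/2 < e^{-0.4812}`: `0.61804 < e^{-0.4812}` (8 Taylor terms). -/
theorem exp_neg_d4812_gt : (61804 / 100000 : ℝ) < Real.exp (-(1203 / 2500)) := by
  have hx : |(-(1203 / 2500) : ℝ)| ≤ 1 := by rw [abs_le]; constructor <;> norm_num
  have h := Real.exp_bound hx (n := 8) (by norm_num)
  have h' := (abs_sub_le_iff.1 h).2
  simp only [sum_range_succ, sum_range_zero, Nat.factorial] at h'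
  norm_num at h'
  linarith

/-- `e^{-0.4813} < 0.61798`. -/
theorem exp_neg_d4813_lt : Real.exp (-(4813 / 10000)) < (61798 / 100000 : ℝ) := by
  have hx : |(-(4813 / 10000) : ℝ)| ≤ 1 := by rw [abs_le]; constructor <;> norm_num
  have h := Real.exp_bound hx (n := 8) (by norm_num)
  have h' := (abs_sub_le_iff.1 h).1
  simp only [sum_range_succ, sum_range_zero, Nat.factorial] at h'
  norm_num at h'
  linarith

/-- **Enclosure** `-0.4813 < log((√5-1)/2) < -0.4812` (`log((√5-1)/2) = -log((1+√5)/2) = -0.48121182…`). -/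
theorem log_golden_inv_bounds :
    -(4813 / 10000 : ℝ) < Real.log ((Real.sqrt 5 - 1) / 2)
    ∧ Real.log ((Real.sqrt 5 - 1) / 2) < -(1203 / 2500) := by
  obtain ⟨hs1, hs2⟩ := sqrt_five_bounds
  have hpos : (0 : ℝ) < (Real.sqrt 5 - 1) / 2 := by linarith
  constructor
  · rw [Real.lt_log_iff_exp_lt hpos]
    linarith [exp_neg_d4813_lt]
  · rw [Real.log_lt_iff_lt_exp hpos]
    linarith [exp_neg_d4812_gt]

/-- **The scaled forms grow at rate `4 log 2 + 4 + 5 log((√5-1)/2) ∈ (4.366, 4.367)`.** Under the Poincaré rates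
of the source (named fact `Zudilin2003.rates`): with the OBSERVED denominators `2^{4n} D_{2n-1}²`,
`(1/n) log(2^{4n} D_{2n-1}² |u_n G - v_n|) → r`, `4.366 < r < 4.367`; the limit is
`4 log 2 + 2·2 + 5 log((√5-1)/2)` by the prime number theorem `log D_m/m → 1` (tree-proved). -/
theorem scaled_forms_rate (h : rates) :
    ∃ r : ℝ, (4366 / 1000 : ℝ) < r ∧ r < 4367 / 1000 ∧
      Tendsto (fun n : ℕ =>
        Real.log ((2 : ℝ) ^ (4 * n) * (Nat.lcmUpto (2 * n - 1) : ℝ) ^ 2 * |form n|) / n) atTop (𝓝 r) := by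
  obtain ⟨-, hne, hf⟩ := h
  set φ' : ℝ := ((Real.sqrt 5 - 1) / 2) with hφ'
  obtain ⟨hl1, hl2⟩ := log_golden_inv_bounds
  have hl2' := Real.log_two_gt_d9
  have hl2'' := Real.log_two_lt_d9
  refine ⟨4 * Real.log 2 + 4 + 5 * Real.log φ', by linarith, by linarith, ?_⟩
  obtain ⟨hs1, _⟩ := sqrt_five_bounds
  have hφpos : 0 < φ' := by rw [hφ']; linarith
  -- (a) `log|f_n|/n → 5 log φ'` from `|f_n|^{1/n} → φ'^5`
  have hlogf : Tendsto (fun n : ℕ => Real.log |form n| / n) atTop (𝓝 (5 * Real.log φ')) := by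
    have h1 : Tendsto (fun n : ℕ => Real.log (|form n| ^ (1 / (n : ℝ)))) atTop
        (𝓝 (Real.log (φ' ^ 5))) :=
      (Real.continuousAt_log (pow_pos hφpos 5).ne').tendsto.comp hf
    rw [Real.log_pow] at h1
    push_cast at h1
    refine h1.congr' ?_
    filter_upwards [eventually_gt_atTop 0] with n hn
    rw [Real.log_rpow (abs_pos.mpr (hne n))]
    ring
  -- (b) `log D_{2n-1}/n → 2`
  have hD : Tendsto (fun n : ℕ => Real.log (Nat.lcmUpto (2 * n - 1)) / n) atTop (𝓝 2) := by
    have hsub : Tendsto (fun n : ℕ => 2 * n - 1) atTop atTop := by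
      refine tendsto_atTop_atTop.mpr fun b => ⟨b + 1, fun n hn => by omega⟩
    have h1 : Tendsto (fun n : ℕ => Real.log (Nat.lcmUpto (2 * n - 1)) / ((2 * n - 1 : ℕ) : ℝ)) atTop
        (𝓝 1) := tendsto_log_lcmUpto_div.comp hsub
    have h2 : Tendsto (fun n : ℕ => (((2 * n - 1 : ℕ) : ℝ)) / n) atTop (𝓝 2) := by
      have e : (fun n : ℕ => (((2 * n - 1 : ℕ) : ℝ)) / n) =ᶠ[atTop] fun n => 2 - 1 / (n : ℝ) := by
        filter_upwards [eventually_ge_atTop 1] with n hn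
        have hn' : (n : ℝ) ≠ 0 := by exact_mod_cast (show n ≠ 0 by omega)
        rw [Nat.cast_sub (by omega)]
        push_cast
        field_simp
      rw [tendsto_congr' e]
      have : Tendsto (fun n : ℕ => (2 : ℝ) - 1 / (n : ℝ)) atTop (𝓝 (2 - 0)) :=
        tendsto_const_nhds.sub tendsto_one_div_atTop_nhds_zero_nat
      simpa using this
    have h3 := h1.mul h2
    simp only [one_mul] at h3
    refine h3.congr' ?_
    filter_upwards [eventually_ge_atTop 1] with n hn
    have hn' : (n : ℝ) ≠ 0 := by exact_mod_cast (show n ≠ 0 by omega)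
    have hm' : (((2 * n - 1 : ℕ) : ℝ)) ≠ 0 := by exact_mod_cast (show 2 * n - 1 ≠ 0 by omega)
    field_simp
  -- (c) assemble
  have hsum : Tendsto (fun n : ℕ => 4 * Real.log 2 + 2 * (Real.log (Nat.lcmUpto (2 * n - 1)) / n)
      + Real.log |form n| / n) atTop (𝓝 (4 * Real.log 2 + 2 * 2 + 5 * Real.log φ')) :=
    (tendsto_const_nhds.add (hD.const_mul 2)).add hlogf
  rw [show (4 : ℝ) * Real.log 2 + 4 + 5 * Real.log φ' = 4 * Real.log 2 + 2 * 2 + 5 * Real.log φ' by ring]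
  refine hsum.congr' ?_
  filter_upwards [eventually_gt_atTop 0] with n hn
  have hd : (0 : ℝ) < (Nat.lcmUpto (2 * n - 1) : ℝ) := by exact_mod_cast Nat.lcmUpto_pos _
  have habs : (0 : ℝ) < |form n| := abs_pos.mpr (hne n)
  have h2 : (0 : ℝ) < (2 : ℝ) ^ (4 * n) := by positivity
  have hn' : (n : ℝ) ≠ 0 := by exact_mod_cast hn.ne'
  rw [Real.log_mul (mul_pos h2 (pow_pos hd 2)).ne' habs.ne', Real.log_mul h2.ne' (pow_pos hd 2).ne',
    Real.log_pow, Real.log_pow]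
  push_cast
  field_simp

/-- **Margin bound (Catalan family).** Under `Zudilin2003.rates`: any decay exponent `c` (`|u_nG - v_n| ≤ e^{-cn}`
eventually) and any denominator exponent `δ` (`2^{4n} D_{2n-1}² ≤ e^{δn}` eventually) satisfy `c - δ < -4.366`:
with these (observed, range-certified) denominators and no savings, the margin of the cell's `Criteria.lean` is
below `-4.366`. -/
theorem margin_lt (h : rates) {c δ : ℝ}
    (hc : ∀ᶠ n : ℕ in atTop, |form n| ≤ Real.exp (-(c * n)))
    (hδ : ∀ᶠ n : ℕ in atTop, (2 : ℝ) ^ (4 * n) * (Nat.lcmUpto (2 * n - 1) : ℝ) ^ 2 ≤ Real.exp (δ * n)) :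
    c - δ < -(4366 / 1000) := by
  obtain ⟨r, hr1, -, hr⟩ := scaled_forms_rate h
  obtain ⟨-, hne, -⟩ := h
  have hle : ∀ᶠ n : ℕ in atTop,
      Real.log ((2 : ℝ) ^ (4 * n) * (Nat.lcmUpto (2 * n - 1) : ℝ) ^ 2 * |form n|) / n ≤ δ - c := by
    filter_upwards [hc, hδ, eventually_gt_atTop 0] with n hcn hδn hn0
    have hd : (0 : ℝ) < (2 : ℝ) ^ (4 * n) * (Nat.lcmUpto (2 * n - 1) : ℝ) ^ 2 := by
      have := Nat.lcmUpto_pos (2 * n - 1); positivity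
    have habs : (0 : ℝ) < |form n| := abs_pos.mpr (hne n)
    have hprod : (2 : ℝ) ^ (4 * n) * (Nat.lcmUpto (2 * n - 1) : ℝ) ^ 2 * |form n|
        ≤ Real.exp (δ * n) * Real.exp (-(c * n)) :=
      mul_le_mul hδn hcn habs.le (Real.exp_pos _).le
    have hlog : Real.log ((2 : ℝ) ^ (4 * n) * (Nat.lcmUpto (2 * n - 1) : ℝ) ^ 2 * |form n|)
        ≤ (δ - c) * n := by
      have := Real.log_le_log (mul_pos hd habs) hprod
      rw [← Real.exp_add, Real.log_exp] at this
      linarith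
    have hn' : (0 : ℝ) < n := by exact_mod_cast hn0
    rw [div_le_iff₀ hn']
    exact hlog
  have hrle : r ≤ δ - c := le_of_tendsto hr hle
  linarith

end Margin

end Summit.KontsevichZagierPeriods.Zeta5Search.CatalanFamily
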